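import Literature.Geometry.ComplexHyperbolic.UnitaryGroupTorusCharacters
import Literature.Geometry.ComplexHyperbolic.UnitaryGroupU3TorusCharacters
import Literature.Analysis.Complex.CircleCharacterClassification
import HarnessLib

/-!
# Unitary characters of `U(2,1)` / `U(3)` on the diagonal torus are integral powers of `det`

Junction of `UnitaryGroupTorusCharacters` / `UnitaryGroupU3TorusCharacters` ((T-det): a character of `U(2,1)` or
`U(3)` restricted to the diagonal torus factors through `det`) with `CircleCharacterClassification` (a continuous
character of `S¹` is `z ↦ z^m`): for a unitary character `χ` whose restriction `z ↦ χ (diag(z,1,1))` is continuous,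
there is ONE integer `m` with `χ (diag(a,b,c)) = (abc)^m` for all unit `a, b, c`.  This is the form in which the
Hodge-CM cell consumes (T-det): the torus weights of the character relating two archimedean splittings are
`(m, m; m)` with `m ∈ ℤ` (carver ruling J-W2glob-3, J-W2glob-5, step (i)). [folklore]
-/

noncomputable section

open Matrix Complex

namespace Literature.Geometry.ComplexHyperbolic

namespace BallModel

open Literature.Analysis.Complex

/-- **`U(2,1)`**: a unitary character continuous on the first torus coordinate is `det^m` on the torus, `m ∈ ℤ`
unique. [folklore] -/
theorem exists_int_map_diagU_eq_zpow (χ : U21 →* Circle) (hc : Continuous fun z : Circle => χ (diagU z 1 1)) :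
    ∃ m : ℤ, ∀ a b c : Circle, χ (diagU a b c) = (a * b * c) ^ m := by
  obtain ⟨m, hm⟩ := CircleChar.exists_eq_zpow (detChar χ) hc
  exact ⟨m, fun a b c => by rw [map_diagU_eq_detChar, hm]⟩

/-- **`U(3)`**: the same for the compact unitary group. [folklore] -/
theorem exists_int_map_diagU3_eq_zpow (χ : U3 →* Circle) (hc : Continuous fun z : Circle => χ (diagU3 z 1 1)) :
    ∃ m : ℤ, ∀ a b c : Circle, χ (diagU3 a b c) = (a * b * c) ^ m := by
  let φ : Circle →* Circle :=
    { toFun := fun z => χ (diagU3 z 1 1)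
      map_one' := by rw [diagU3_one, map_one]
      map_mul' := fun z w => by rw [← map_mul, diagU3_mul, mul_one] }
  obtain ⟨m, hm⟩ := CircleChar.exists_eq_zpow φ hc
  exact ⟨m, fun a b c => by rw [unitaryGroup_map_diagU3_eq]; exact hm (a * b * c)⟩

/-! ## `ℂˣ`-valued characters (appended, unit `pub-hodgecm-mc-binder-1-g3`)

The discrepancy characters of the see-saw renormalisation (`NumberTheory/Automorphic/AdelicSchwartzBruhatTensorCharacter`,
`continuous_charV`) are `ℂˣ`-valued with continuous `ℂ`-values; on the compact torus they are unitary
(`CircleChar.norm_map_eq_one`), so the same integrality holds. -/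

/-- **`U(2,1)`, `ℂˣ`-valued**: a character `χ : U(2,1) →* ℂˣ` whose first torus coordinate `z ↦ χ (diag(z,1,1))` is
continuous as a `ℂ`-valued function is `det^m` on the torus, `m ∈ ℤ`. [folklore] -/
theorem exists_int_map_diagU_eq_zpow_of_units (χ : U21 →* ℂˣ)
    (hc : Continuous fun z : Circle => (χ (diagU z 1 1) : ℂ)) :
    ∃ m : ℤ, ∀ a b c : Circle, (χ (diagU a b c) : ℂ) = ((a * b * c : Circle) : ℂ) ^ m := by
  obtain ⟨m, hm⟩ := CircleChar.exists_eq_zpow_of_units (detChar χ) hc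
  exact ⟨m, fun a b c => by rw [map_diagU_eq_detChar, hm]⟩

/-- **`U(3)`, `ℂˣ`-valued**: the same for the compact unitary group. [folklore] -/
theorem exists_int_map_diagU3_eq_zpow_of_units (χ : U3 →* ℂˣ)
    (hc : Continuous fun z : Circle => (χ (diagU3 z 1 1) : ℂ)) :
    ∃ m : ℤ, ∀ a b c : Circle, (χ (diagU3 a b c) : ℂ) = ((a * b * c : Circle) : ℂ) ^ m := by
  let φ : Circle →* ℂˣ :=
    { toFun := fun z => χ (diagU3 z 1 1)
      map_one' := by rw [diagU3_one, map_one]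
      map_mul' := fun z w => by rw [← map_mul, diagU3_mul, mul_one] }
  obtain ⟨m, hm⟩ := CircleChar.exists_eq_zpow_of_units φ hc
  exact ⟨m, fun a b c => by rw [unitaryGroup_map_diagU3_eq]; exact hm (a * b * c)⟩

end BallModel

end Literature.Geometry.ComplexHyperbolic

end
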